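import Summits.NavierStokesRegularity.NavierStokesRegularity.Theorems.TerminalTraceTypeITraceScarL3LocalEnergyIdentityTop

/-!
# The local energy inequality AT the blow-up time and the concentration defect — no Type-I hypothesis

Helper file for item `TerminalTrace.TypeITraceScarL3` (stmt-NavierStokesRegularity-18385), seat
nsreg-C26-p1 g4 (cell ns-regularity-ideate), `--supports … --as helper`.

`TerminalTraceTypeITraceScarL3LocalEnergyIdentityTop` proved, WITHOUT Type I, that for the item's classical
Leray–Hopf solution `(u,p)` on `[0,T) × ℝ³` the cut-off energy `t ↦ ∫ φ|u(t)|²` has a left limit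
`L_φ = ∫ φ|u(t₀)|² − 2ν ∫_{(t₀,T)}∫|∇u|²φ + ∫_{(t₀,T)} F_φ` at `T` (`tendsto_integral_cutoff_normSq_nhdsLT`),
and, UNDER Type I, that `L_φ = ∫ φ|u(T)|²` (`localEnergyIdentity_top`).  This file records the Type-I-FREE
half of the picture, i.e. what the Leray–Hopf structure alone gives at the top time:

* `tendsto_inner_cutoff_top` — the weak term `∫⟪u(t), φ u(T)⟫ → ∫ φ|u(T)|²` as `t ↑ T` (weak `L²`
  continuity of the Leray–Hopf slices; `φ` continuous with compact support);
* `integral_cutoff_normSq_sub_eq` — the algebraic decomposition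
  `∫ φ|u(t) − u(T)|² = (∫ φ|u(t)|² − ∫ φ|u(T)|²) − 2(∫⟪u(t), φu(T)⟫ − ∫ φ|u(T)|²)`;
* `tendsto_integral_cutoff_normSq_sub_top_nhdsLT` — hence the CONCENTRATION DEFECT
  `D_φ := lim_{t ↑ T} ∫ φ|u(t) − u(T)|²` EXISTS for every cut-off `0 ≤ φ ∈ C_c^∞` and equals
  `L_φ − ∫ φ|u(T)|²` (the test-function form of Leslie–Shvydkoy's energy measure at `T` minus its
  absolutely continuous part `|u(T)|² dx`);
* `integral_cutoff_normSq_top_le` / `localEnergyInequality_top` — `D_φ ≥ 0`, i.e. the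
  Caffarelli–Kohn–Nirenberg local energy inequality holds AT the blow-up time for every cut-off:
  `∫ φ|u(T)|² − ∫ φ|u(t₀)|² + 2ν ∫_{(t₀,T)}∫|∇u|²φ ≤ ∫_{(t₀,T)} F_φ`;
* `localEnergyIdentity_top_iff_noConcentration` — equality holds iff `∫ φ|u(t) − u(T)|² → 0`, so
  `localEnergyIdentity_top` (Type I) is exactly the statement `D_φ = 0` for all `φ`.

WHAT THIS IS NOT: not a statement about singular points, not 18385, NOT Navier–Stokes regularity.

References: J. Leray, Acta Math. 63 (1934) §33 (energy inequality of turbulent solutions);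
L. Caffarelli, R. Kohn, L. Nirenberg, CPAM 35 (1982) §2 (2.5); T. Leslie, R. Shvydkoy,
arXiv:1705.04420, §1 (energy measure) and Thm. 1.2. [Leray1934] [CaffarelliKohnNirenberg1982]
[LeslieShvydkoy2017]
-/

noncomputable section

set_option linter.dupNamespace false

open MeasureTheory TopologicalSpace Set Function Filter Metric
open _root_.Topology
open scoped Laplacian InnerProductSpace RealInnerProductSpace ENNReal NNReal ContDiff

namespace Summit.NavierStokesRegularity.NavierStokesRegularity.Theorems.TypeITraceScarL3

open Literature.Analysis.FluidPDE

/-- **The weak term at the top time**: for a Leray–Hopf solution on `[0,T]` and a continuous compactly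
supported weight `φ`, `∫⟪u(t), φ u(T)⟫ → ∫ φ|u(T)|²` as `t ↑ T` (weak `L²` continuity of the slices,
tested against `φ u(T) ∈ L²`). No Type-I hypothesis. [cite: Leray1934, §33] -/
theorem tendsto_inner_cutoff_top {ν T : ℝ} (hT : 0 < T)
    {u : ℝ → EuclideanSpace ℝ (Fin 3) → EuclideanSpace ℝ (Fin 3)}
    (hLH : IsLerayHopfOn T ν 0 (u 0) u)
    {φ : EuclideanSpace ℝ (Fin 3) → ℝ} (hφ : Continuous φ) (hφc : HasCompactSupport φ) :
    Tendsto (fun t => ∫ x, ⟪u t x, φ x • u T x⟫) (𝓝[<] T) (𝓝 (∫ x, φ x * ‖u T x‖ ^ 2)) := by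
  obtain ⟨Φ, hΦ⟩ := hφ.bounded_above_of_compact_support hφc
  have hUT : MemLp (u T) 2 volume := hLH.memLp T ⟨hT.le, le_rfl⟩
  set w : EuclideanSpace ℝ (Fin 3) → EuclideanSpace ℝ (Fin 3) := fun x => φ x • u T x with hw_def
  have hw : MemLp w 2 volume := by
    refine MemLp.of_le_mul (c := Φ) hUT (hφ.aestronglyMeasurable.smul hUT.aestronglyMeasurable)
      (Eventually.of_forall fun x => ?_)
    rw [hw_def, norm_smul]
    exact mul_le_mul_of_nonneg_right (hΦ x) (norm_nonneg _)
  have hc := (hLH.weak_continuous w hw).1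
  have hcT : ContinuousWithinAt (fun t => ∫ x, ⟪u t x, w x⟫) (Ioc 0 T) T := hc T ⟨hT, le_rfl⟩
  have hval : (∫ x, ⟪u T x, w x⟫) = ∫ x, φ x * ‖u T x‖ ^ 2 := by
    refine integral_congr_ae (Eventually.of_forall fun x => ?_)
    simp only [hw_def, real_inner_smul_right, real_inner_self_eq_norm_sq]
  rw [← nhdsWithin_Ioo_eq_nhdsLT hT, ← hval]
  exact hcT.tendsto.mono_left (nhdsWithin_mono _ Ioo_subset_Ioc_self)

/-- **The decomposition of the concentration defect**: for a Leray–Hopf solution on `[0,T]`, a continuous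
compactly supported weight `φ` and `t ∈ [0,T]`,
`∫ φ|u(t) − u(T)|² = (∫ φ|u(t)|² − ∫ φ|u(T)|²) − 2 (∫⟪u(t), φ u(T)⟫ − ∫ φ|u(T)|²)`.
Pure `L²` algebra. [folklore] -/
theorem integral_cutoff_normSq_sub_eq {ν T : ℝ} (hT : 0 < T)
    {u : ℝ → EuclideanSpace ℝ (Fin 3) → EuclideanSpace ℝ (Fin 3)}
    (hLH : IsLerayHopfOn T ν 0 (u 0) u)
    {φ : EuclideanSpace ℝ (Fin 3) → ℝ} (hφ : Continuous φ) (hφc : HasCompactSupport φ)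
    {t : ℝ} (ht : t ∈ Icc 0 T) :
    ∫ x, φ x * ‖u t x - u T x‖ ^ 2 =
      ((∫ x, φ x * ‖u t x‖ ^ 2) - ∫ x, φ x * ‖u T x‖ ^ 2) -
        2 * ((∫ x, ⟪u t x, φ x • u T x⟫) - ∫ x, φ x * ‖u T x‖ ^ 2) := by
  obtain ⟨Φ, hΦ⟩ := hφ.bounded_above_of_compact_support hφc
  have hφm : AEStronglyMeasurable φ volume := hφ.aestronglyMeasurable
  have hUT : MemLp (u T) 2 volume := hLH.memLp T ⟨hT.le, le_rfl⟩
  have hUt : MemLp (u t) 2 volume := hLH.memLp t ht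
  set w : EuclideanSpace ℝ (Fin 3) → EuclideanSpace ℝ (Fin 3) := fun x => φ x • u T x with hw_def
  have hw : MemLp w 2 volume := by
    refine MemLp.of_le_mul (c := Φ) hUT (hφm.smul hUT.aestronglyMeasurable)
      (Eventually.of_forall fun x => ?_)
    rw [hw_def, norm_smul]
    exact mul_le_mul_of_nonneg_right (hΦ x) (norm_nonneg _)
  have hint2 : ∀ g : EuclideanSpace ℝ (Fin 3) → EuclideanSpace ℝ (Fin 3), MemLp g 2 volume →
      Integrable fun x => φ x * ‖g x‖ ^ 2 := fun g hg =>
    (hg.integrable_norm_pow two_ne_zero).bdd_mul hφm (Eventually.of_forall hΦ)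
  have i1 := hint2 (u t) hUt
  have i2 := hint2 (u T) hUT
  have i3 : Integrable fun x => ⟪u t x, w x⟫ := integrable_inner_of_memLp_two hUt hw
  have i5 : Integrable fun x => φ x * ‖u t x - u T x‖ ^ 2 :=
    hint2 (fun x => u t x - u T x) (hUt.sub hUT)
  have i32 : Integrable fun x => 2 * (⟪u t x, w x⟫ - φ x * ‖u T x‖ ^ 2) := (i3.sub i2).const_mul 2
  have i12 : Integrable fun x => φ x * ‖u t x‖ ^ 2 - φ x * ‖u T x‖ ^ 2 := i1.sub i2
  rw [← integral_sub i1 i2, ← integral_sub i3 i2, ← integral_const_mul, ← integral_sub i12 i32]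
  refine integral_congr_ae (Eventually.of_forall fun x => ?_)
  simp only [hw_def, real_inner_smul_right, norm_sub_sq_real]
  ring

/-- **The concentration defect exists at the blow-up time** (no Type-I hypothesis): for the item's
classical Leray–Hopf solution `(u,p)` on `[0,T) × ℝ³` (viscosity `ν > 0`), every cut-off `0 ≤ φ ∈ C_c^∞(ℝ³)`
and `t₀ ∈ (0,T)`, `∫ φ|u(t) − u(T)|²` converges as `t ↑ T`, to
`D_φ = (∫ φ|u(t₀)|² − 2ν ∫_{(t₀,T)}∫|∇u|²φ + ∫_{(t₀,T)} F_φ) − ∫ φ|u(T)|²`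
with `F_φ = ∫ (νΔφ|u|² + Dφ(u)|u|² + 2pDφ(u))` — the test-function form of the Leslie–Shvydkoy energy
measure at `T` with its absolutely continuous part `|u(T)|²dx` removed.
[cite: LeslieShvydkoy2017, §1 and Thm. 1.2; CaffarelliKohnNirenberg1982, §2 (2.5)] -/
theorem tendsto_integral_cutoff_normSq_sub_top_nhdsLT {ν T : ℝ} (hν : 0 < ν) (hT : 0 < T)
    {u : ℝ → EuclideanSpace ℝ (Fin 3) → EuclideanSpace ℝ (Fin 3)}
    {p : ℝ → EuclideanSpace ℝ (Fin 3) → ℝ}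
    (hcl : IsClassicalNSSolutionOn (Set.Ico 0 T) ν 0 u p) (hLH : IsLerayHopfOn T ν 0 (u 0) u)
    {φ : EuclideanSpace ℝ (Fin 3) → ℝ} (hφ : ContDiff ℝ ∞ φ) (hφc : HasCompactSupport φ)
    (hφ0 : ∀ x, 0 ≤ φ x) {t₀ : ℝ} (ht₀ : t₀ ∈ Ioo 0 T) :
    Tendsto (fun t => ∫ x, φ x * ‖u t x - u T x‖ ^ 2) (𝓝[<] T)
      (𝓝 (((∫ x, φ x * ‖u t₀ x‖ ^ 2) -
        2 * ν * (∫ s in Ioo t₀ T, ∫ x, frobeniusNormSq (fderiv ℝ (u s) x) * φ x) +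
        ∫ s in Ioo t₀ T, ∫ x, (ν * ((Δ φ) x * ‖u s x‖ ^ 2) +
          fderiv ℝ φ x (u s x) * ‖u s x‖ ^ 2 + 2 * (p s x * fderiv ℝ φ x (u s x)))) -
        ∫ x, φ x * ‖u T x‖ ^ 2)) := by
  have hlim := tendsto_integral_cutoff_normSq_nhdsLT hν hT hcl hLH hφ hφc hφ0 ht₀
  have hweak := tendsto_inner_cutoff_top hT hLH hφ.continuous hφc
  have hsum := (hlim.sub_const (∫ x, φ x * ‖u T x‖ ^ 2)).sub
    ((hweak.sub_const (∫ x, φ x * ‖u T x‖ ^ 2)).const_mul 2)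
  simp only [sub_self, mul_zero, sub_zero] at hsum
  refine hsum.congr' ?_
  filter_upwards [Ioo_mem_nhdsLT ht₀.2] with t ht
  exact (integral_cutoff_normSq_sub_eq hT hLH hφ.continuous hφc ⟨(ht₀.1.trans ht.1).le, ht.2.le⟩).symm

/-- **The cut-off energy does not increase through the blow-up time** (no Type-I hypothesis): with the
notation of `tendsto_integral_cutoff_normSq_sub_top_nhdsLT`, `∫ φ|u(T)|² ≤ lim_{t ↑ T} ∫ φ|u(t)|²`, i.e.
`∫ φ|u(T)|² ≤ ∫ φ|u(t₀)|² − 2ν ∫_{(t₀,T)}∫|∇u|²φ + ∫_{(t₀,T)} F_φ` (the defect `D_φ` is `≥ 0`: weak lower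
semicontinuity of the weighted `L²` norm along the Leray–Hopf slices).
[cite: Leray1934, §33; CaffarelliKohnNirenberg1982, §2 (2.5)] -/
theorem integral_cutoff_normSq_top_le {ν T : ℝ} (hν : 0 < ν) (hT : 0 < T)
    {u : ℝ → EuclideanSpace ℝ (Fin 3) → EuclideanSpace ℝ (Fin 3)}
    {p : ℝ → EuclideanSpace ℝ (Fin 3) → ℝ}
    (hcl : IsClassicalNSSolutionOn (Set.Ico 0 T) ν 0 u p) (hLH : IsLerayHopfOn T ν 0 (u 0) u)
    {φ : EuclideanSpace ℝ (Fin 3) → ℝ} (hφ : ContDiff ℝ ∞ φ) (hφc : HasCompactSupport φ)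
    (hφ0 : ∀ x, 0 ≤ φ x) {t₀ : ℝ} (ht₀ : t₀ ∈ Ioo 0 T) :
    ∫ x, φ x * ‖u T x‖ ^ 2 ≤
      (∫ x, φ x * ‖u t₀ x‖ ^ 2) -
        2 * ν * (∫ s in Ioo t₀ T, ∫ x, frobeniusNormSq (fderiv ℝ (u s) x) * φ x) +
        ∫ s in Ioo t₀ T, ∫ x, (ν * ((Δ φ) x * ‖u s x‖ ^ 2) +
          fderiv ℝ φ x (u s x) * ‖u s x‖ ^ 2 + 2 * (p s x * fderiv ℝ φ x (u s x))) := by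
  have h := tendsto_integral_cutoff_normSq_sub_top_nhdsLT hν hT hcl hLH hφ hφc hφ0 ht₀
  have hnonneg : 0 ≤ ((∫ x, φ x * ‖u t₀ x‖ ^ 2) -
        2 * ν * (∫ s in Ioo t₀ T, ∫ x, frobeniusNormSq (fderiv ℝ (u s) x) * φ x) +
        ∫ s in Ioo t₀ T, ∫ x, (ν * ((Δ φ) x * ‖u s x‖ ^ 2) +
          fderiv ℝ φ x (u s x) * ‖u s x‖ ^ 2 + 2 * (p s x * fderiv ℝ φ x (u s x)))) -
        ∫ x, φ x * ‖u T x‖ ^ 2 :=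
    ge_of_tendsto h (Eventually.of_forall fun t =>
      integral_nonneg fun x => mul_nonneg (hφ0 x) (sq_nonneg _))
  linarith

/-- **The Caffarelli–Kohn–Nirenberg local energy inequality AT the blow-up time, for every cut-off**
(no Type-I hypothesis): for the item's classical Leray–Hopf solution `(u,p)` on `[0,T) × ℝ³`,
`0 ≤ φ ∈ C_c^∞(ℝ³)` and `t₀ ∈ (0,T)`, both time integrands are integrable on `(t₀,T)` and
`∫ φ|u(T)|² − ∫ φ|u(t₀)|² + 2ν ∫_{(t₀,T)}∫|∇u|²φ ≤ ∫_{(t₀,T)}∫ (νΔφ|u|² + Dφ(u)|u|² + 2pDφ(u))`.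
Compare `localEnergyIdentity_top`: under Type I in time this is an equality.
[cite: CaffarelliKohnNirenberg1982, §2 (2.5); Leray1934, §33] -/
theorem localEnergyInequality_top {ν T : ℝ} (hν : 0 < ν) (hT : 0 < T)
    {u : ℝ → EuclideanSpace ℝ (Fin 3) → EuclideanSpace ℝ (Fin 3)}
    {p : ℝ → EuclideanSpace ℝ (Fin 3) → ℝ}
    (hcl : IsClassicalNSSolutionOn (Set.Ico 0 T) ν 0 u p) (hLH : IsLerayHopfOn T ν 0 (u 0) u)
    {φ : EuclideanSpace ℝ (Fin 3) → ℝ} (hφ : ContDiff ℝ ∞ φ) (hφc : HasCompactSupport φ)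
    (hφ0 : ∀ x, 0 ≤ φ x) {t₀ : ℝ} (ht₀ : t₀ ∈ Ioo 0 T) :
    IntegrableOn (fun s => ∫ x, frobeniusNormSq (fderiv ℝ (u s) x) * φ x) (Ioo t₀ T) ∧
    IntegrableOn (fun s => ∫ x, (ν * ((Δ φ) x * ‖u s x‖ ^ 2) +
      fderiv ℝ φ x (u s x) * ‖u s x‖ ^ 2 + 2 * (p s x * fderiv ℝ φ x (u s x)))) (Ioo t₀ T) ∧
    (∫ x, φ x * ‖u T x‖ ^ 2) - (∫ x, φ x * ‖u t₀ x‖ ^ 2) +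
        2 * ν * (∫ s in Ioo t₀ T, ∫ x, frobeniusNormSq (fderiv ℝ (u s) x) * φ x) ≤
      ∫ s in Ioo t₀ T, ∫ x, (ν * ((Δ φ) x * ‖u s x‖ ^ 2) +
        fderiv ℝ φ x (u s x) * ‖u s x‖ ^ 2 + 2 * (p s x * fderiv ℝ φ x (u s x))) := by
  refine ⟨integrableOn_dissipation_Ioo hν hT hcl hLH hφ hφc hφ0 ht₀,
    (integrableOn_flux_Ioo hν hT hcl hLH hφ hφc).mono_set (Ioo_subset_Ioo_left ht₀.1.le), ?_⟩
  have := integral_cutoff_normSq_top_le hν hT hcl hLH hφ hφc hφ0 ht₀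
  linarith

/-- **Local energy identity at `T` ⇔ no concentration against `φ`** (no Type-I hypothesis): for the
item's classical Leray–Hopf solution, `0 ≤ φ ∈ C_c^∞` and `t₀ ∈ (0,T)`, the CKN inequality of
`localEnergyInequality_top` is an EQUALITY iff the concentration defect vanishes,
`∫ φ|u(t) − u(T)|² → 0` as `t ↑ T`.  (Under Type I the right-hand side holds for every `φ`:
`tendsto_localEnergy_sub_top`, whence `localEnergyIdentity_top`.)
[cite: LeslieShvydkoy2017, §1 and Thm. 1.2] -/
theorem localEnergyIdentity_top_iff_noConcentration {ν T : ℝ} (hν : 0 < ν) (hT : 0 < T)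
    {u : ℝ → EuclideanSpace ℝ (Fin 3) → EuclideanSpace ℝ (Fin 3)}
    {p : ℝ → EuclideanSpace ℝ (Fin 3) → ℝ}
    (hcl : IsClassicalNSSolutionOn (Set.Ico 0 T) ν 0 u p) (hLH : IsLerayHopfOn T ν 0 (u 0) u)
    {φ : EuclideanSpace ℝ (Fin 3) → ℝ} (hφ : ContDiff ℝ ∞ φ) (hφc : HasCompactSupport φ)
    (hφ0 : ∀ x, 0 ≤ φ x) {t₀ : ℝ} (ht₀ : t₀ ∈ Ioo 0 T) :
    ((∫ x, φ x * ‖u T x‖ ^ 2) - (∫ x, φ x * ‖u t₀ x‖ ^ 2) +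
        2 * ν * (∫ s in Ioo t₀ T, ∫ x, frobeniusNormSq (fderiv ℝ (u s) x) * φ x) =
      ∫ s in Ioo t₀ T, ∫ x, (ν * ((Δ φ) x * ‖u s x‖ ^ 2) +
        fderiv ℝ φ x (u s x) * ‖u s x‖ ^ 2 + 2 * (p s x * fderiv ℝ φ x (u s x)))) ↔
    Tendsto (fun t => ∫ x, φ x * ‖u t x - u T x‖ ^ 2) (𝓝[<] T) (𝓝 0) := by
  have h := tendsto_integral_cutoff_normSq_sub_top_nhdsLT hν hT hcl hLH hφ hφc hφ0 ht₀
  constructor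
  · intro heq
    convert h using 2
    linarith
  · intro h0
    have := tendsto_nhds_unique h h0
    linarith

end Summit.NavierStokesRegularity.NavierStokesRegularity.Theorems.TypeITraceScarL3

end
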